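import Summits.QuantumFields.YangMills.Theorems.BalabanUVNodesN15SiteCurvedLaplacianLetters
import Summits.QuantumFields.YangMills.Theorems.BalabanUVNodesN15CurvedPerturbationLettersSpecies
import Summits.QuantumFields.YangMills.Theorems.BalabanUVNodesN15CurvedDressedPairExp
import HarnessLib

/-!
# Route «BalabanUVNodes», cluster K4 «SpineRates» — node N15 = NE2: THE SITE LAYER WITH THE BACKGROUND LIVE IN THE TwoGrid ENTRY CURRENCY, XXXIX — ENTRY 3 OF THE CURVED KING
# FAMILY's OPERATOR LAYER DISCHARGED: `𝔇(Δ′X′, ΔX̄) ≤ C₃·(L^K)^{−¼}·e^{−δ₃|y−y′|_T}` for the flat Laplacian of King's massless propagator `⊗ 1` dressed by the EXACT adjoint transporters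
# `Ad(e^{η′A′})`, uniformly on the one-step King family in the (3.35) window (part XXXVI §3's displayed row `h3`, now a theorem)

Cell `pub-ymgap`, WIDTH SEAT `pub-ymgap-dag-n15-w1` (generation 5; director-ym №197 ∕ HUMAN RULING D-0149, №219 (1); chair R455 (A) ∕ R461; dag-lead KEY MAP v2 INBOX l.35754; the
located sequel (o1) of dag-n15-e g15 INBOX l.39322 ∕ l.39620; CLAIM-4 l.40468).  `bears_on: R4∕N15 · K3⁸ SpineGivenEndpointR13SepCoPHV (stmt-QuantumFields-27366; K3⁷ 20544 aside)`.
Filed `--kind proof --supports stmt-QuantumFields-27366 --as helper` — COUNT-NEUTRAL.  ONE THEOREM (0 `def`, 0 `sorry`).  Imports BY NAME part XXXVIII `…N15SiteCurvedLaplacianLetters`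
(`curvLap_letters_massRange`, `hasMaj_idef_derived_of_letters`; through it XXXVI `curvOpT`, XXXIII `curvXfo∕curvXco_avg`, XXXII `uN_hasMaj_idef_curvDressed_kingTorus_king_field_closed_massRange`,
XXX `kingFullProp_layer_backward_massRange`), dag-n15-w2 g5 `…CurvedPerturbationLettersSpecies` (`hasMaj_unstackM_curvCoef_exp_rate_of_skew`, `hasMaj_idef_unstackM_curvCoef_exp_rate_of_skew`),
dag-n15-w2 `…CurvedDressedPairExp` (`hasMaj_curvDressed_exp_of_skew`, `isUnit_curvDressed_exp_of_skew`), dag-n15-w3's block-mean fits, dag-n15-c M1 `projO_none_bgPairM`; tree unmodified.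

WHY ∕ HOW.  By (3.65) (M1 `projO_none_bgPairM`) `ΔX = ΔG + (ΔG·V̂)·X̂` on both grids, so part XXXVIII §5's generic knit gives the η-defect of entry 3 from: the Laplacian letters (XXXVIII §4,
dag-n15-e Σ-a), the species rows∕defect (dag-n15-w2 g5; the window's three small-field letters through `‖ad_X‖ ≤ 2‖X‖` and dag-n15-w3's block-mean fits), the pair defect (XXXII), the coarse
pair's rows and the two Neumann units (dag-n15-w2; smallness `β₁R_V(2t)c_r ≤ ½` DISCHARGED by the window `M_sz·α₀ ≤ b₃`, XXXII's bookkeeping) — all at `m² = 0`, ONE constant block.  The bundle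
with ONLY entry 2 displayed is the two-line sequel part XL (entry 2 = the located Calderón–Zygmund obstruction, dag-n15-e l.39620 (B) ∕ dag-n15-d l.40235 (1); door: right-dressing, (2)).

HONEST FRAMING ∕ LIMITS.  Count-neutral KNIT (Leibniz + (2.52)–(2.56) + constants over LANDED letters); no new analytic estimate.  MODEL-LEVEL: King's `A = 0` massless propagator
dressed by the exact adjoint transporter of a small potential, ONE blocking step, block-mean coarse potential, FLAT base point and FLAT Laplacian; NOT Bałaban's `Δ_U G(U)`; nothing of
[B5]∕[B6]∕[B9] asserted ((3.35)–(3.37) p. 396, Thm 3.1 (3.42) p. 397, (3.63)–(3.65) pp. 402–403 = SHAPES ∕ MECHANISM; [King1986] (2.17) p. 653, Prop. 3.8 (3.71) p. 664, Prop. 3.9 (3.73)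
p. 665, (4.1)–(4.5) p. 670 = the typed model).  NE2⁺ NOT PRINTED ∕ NOT proved for d = 4; **N15 is NOT discharged**; K3⁸ OPEN, not claimed, skeleton v6 untouched; counts of record UNMOVED
(typed 28∕28 · discharged 5∕27, A 5∕28); one finite four-torus programme at fixed `ε` — NOT ℝ⁴, NOT OS, NOT a mass gap, NOT Clay; R4 = the conditional finite-𝕋⁴ rung only.  Restate-immune.
-/

set_option autoImplicit false

noncomputable section
open scoped BigOperators Matrix Matrix.Norms.Frobenius
namespace Summit.QuantumFields.YangMills.BalabanUVNodes.N15.SiteLayerBg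

open Finset NormedSpace
open Literature.MathematicalPhysics.QuantumFieldTheory.Balaban1983to89
open Literature.MathematicalPhysics.QuantumFieldTheory.Balaban1983to89.B11SectG (BlockNorm HasMaj RowSum hasMaj_comp_exp)
open Literature.MathematicalPhysics.QuantumFieldTheory.Balaban1983to89.B6RandomWalk (Triangle254)
open Literature.MathematicalPhysics.QuantumFieldTheory.Balaban1983to89.B6UnitTorusCarrier (unitTorusGeo triangle254_unitTorusGeo rowSum_unitTorusGeo)
open Literature.MathematicalPhysics.QuantumFieldTheory.Balaban1983to89.B9SectDSup (inv_one_sub_le_two)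
open Literature.MathematicalPhysics.QuantumFieldTheory.Balaban1983to89.T4EtaRateDefect (idef idef_apply idef_comp idef_add)
open Literature.MathematicalPhysics.QuantumFieldTheory.Balaban1983to89.T4EtaRateCoeffDefect (pull pull_apply coeff_osc_rate)
open Literature.MathematicalPhysics.QuantumFieldTheory.Balaban1983to89.B5Prop11Plancherel (Tor fine unitVec)
open Literature.MathematicalPhysics.QuantumFieldTheory.King1986 (aK aK_pos)
open Literature.MathematicalPhysics.QuantumFieldTheory.King1986.Torus (blockOf tdistT tdistT_nonneg tdistT_self)
open Literature.MathematicalPhysics.QuantumFieldTheory.Balaban1983to89.Beta.AveragingCorrectionJets (adCLM norm_adCLM_le adCLM_smul)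
open Literature.Barriers.QuantumFields (traceForm)
open Summit.QuantumFields.YangMills.BalabanUVNodes.N15.VectorPiece (unitTorusGeoS tensorId hasMaj_tensorId)
open Summit.QuantumFields.YangMills.BalabanUVNodes.N15.MatrixSpecies (liftMap liftBlk liftEquiv coordMat coordMat_sub basisConst basisConst_nonneg Phi0 adCLM_sub)
open Summit.QuantumFields.YangMills.BalabanUVNodes.N15.BackgroundLayer (liftPair blkPair projO coordMat_smul coordMat_one unstackM projO_none_bgPairM)
open Summit.QuantumFields.YangMills.BalabanUVNodes.N15.CurvedSpecies (torStep blockMeanField blockMeanTV covPieces covPieces_one gaugePair gaugePair_one curvDressed curvCoefC curvCoefA expTrField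
  expTrField_apply expRowLetter expFitLetter torStep_symm_apply coordMat_adCLM_transpose_eq_neg_of_conjTranspose expRowLetter_nonneg expFitLetter_nonneg expRowLetter_field_le expRowLetter_field_eq
  expFitLetter_field_le expFitLetter_field_eq basisConst_le_sqrt_card_of_traceForm hasMaj_unstackM_curvCoef_exp_rate_of_skew hasMaj_idef_unstackM_curvCoef_exp_rate_of_skew
  hasMaj_curvDressed_exp_of_skew isUnit_curvDressed_exp_of_skew norm_blockMeanTV_le gradLetter_blockMean fit_blockMeanTV blockOf_compat_addRight fitTranslated_of_fit_of_compat
  fit_bdiffTV_blockMeanTV blockMeanTV_skew)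
open Summit.QuantumFields.YangMills.BalabanUVNodes.N15.CoefficientSpecies (species2_rate)
open Summit.QuantumFields.YangMills.BalabanUVNodes.N15KingModelRung (KingVolIndex)
open Summit.QuantumFields.YangMills.BalabanUVNodes.N15KingModelRung.Curved

variable {d : ℕ} (L : ℕ) [NeZero L]
/-! ## ★★★ The entry-3 row of the curved King family -/
section Letters3
variable {n : Type} [Fintype n] [DecidableEq n] (κ : Type) [Fintype κ] [DecidableEq κ] (e : Matrix n n ℂ ≃L[ℝ] (κ → ℝ)) (a : ℝ)
set_option maxHeartbeats 400000 in
/-- ★★★ **THE (3.42)-SHAPED ROW OF ENTRY 3, ONE CONSTANT BLOCK** (part XXXVI §3's displayed `h3`, DISCHARGED).  For odd `L ≥ 3`, `a > 0`, trace-form-orthonormal coordinates `e` of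
`M_N(ℂ)` and any `c₃₅` there are `δ₃, C₃, b₃ > 0` such that for every index `(i, μ)`, every `α₀ > 0` with `M_sz·α₀ ≤ b₃` and every potential `A′` in the window `Reg335 c₃₅ α₀`: the
η-difference operator of entry 3 — `𝔇(Δ′X′(A′), ΔX̄(Ā′))`, flat Laplacians `N²Δ ⊗ 1` of the exact-transporter-dressed massless King propagators of the two runs — has the block majorant
`C₃·(L^K)^{−¼}·e^{−δ₃|y−y′|_T}`.  §1 at `m² = 0` on: part XXXVIII's Laplacian letters, dag-n15-w2 g5's species letters (fed the window's three letters through `‖ad_X‖ ≤ 2‖X‖` and dag-n15-w3's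
block-mean fits), part XXXII's pair defect, dag-n15-w2's coarse pair rows with the Neumann smallness DISCHARGED by the window (`β·R_V·c_r ≤ ½` for `M_sz·α₀ ≤ b₃`, as in part XXXII).
[cite: Balaban1985BackgroundPropagators, Thm 3.1 (3.42) p.397 (fourth entry: shape), (3.35)–(3.37) p.396, (3.63)–(3.65) pp.402–403 (mechanism); King1986, (2.17) p.653, Prop. 3.8 (3.71) p.664, Prop. 3.9 (3.73) p.665, p.664 (pairing); Balaban1984PropagatorsII, (2.52)–(2.56) pp.232–233] -/
theorem curvOp_letters3 (he : ∀ X Y : Matrix n n ℂ, traceForm X Y = e X ⬝ᵥ e Y) (hLodd : Odd L) (hL : 2 ≤ L) (ha : 0 < a) (c35 : ℝ) :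
    ∃ δ₃ C₃ b₃ : ℝ, 0 < δ₃ ∧ 0 < C₃ ∧ 0 < b₃ ∧ ∀ (i : KingVolIndex d × Fin (d + 1)) (α₀ : ℝ), 0 < α₀ → i.1.Msz * α₀ ≤ b₃ → ∀ U : (curvBgF L n i.1).Cfg, (curvBgF L n i.1).Reg335 c35 α₀ U →
        HasMaj (BlockNorm.ofBlocks (unitTorusGeoS L i.1.K (curvCube L i.1) i.1.Msz) (liftBlk (blockOf (L ^ i.1.K) (curvCube L i.1)) κ))
          (BlockNorm.ofBlocks (unitTorusGeoS L i.1.K (curvCube L i.1) i.1.Msz) (liftBlk (blockOf (L ^ i.1.K) (curvCube L i.1) ∘ blockOf L (fine (L ^ i.1.K) (curvCube L i.1))) κ))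
          (curvOpT L κ e a i 3 U) (fun y y' => C₃ * ((L : ℝ) ^ i.1.K) ^ (-(1 / 4 : ℝ)) * Real.exp (-(δ₃ * tdistT (curvCube L i.1) y y'))) := by
  -- (0) the three level-independent packages: King's nine letters (part XXX), the Laplacian letters (part XXXVIII), the pair defect (part XXXII), all on the closed mass range
  obtain ⟨β₁, δ₁, m₁, hβ₁, hδ₁, hm₁, H₁⟩ := kingFullProp_layer_backward_massRange (d := d) L hLodd hL ha le_rfl (γ := 1 / 2) (by norm_num) (by norm_num) (α := 1 / 2)
    (by norm_num) (by norm_num)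
  obtain ⟨β₂, δ₂, m₂, hβ₂, hδ₂, hm₂, H₂⟩ := curvLap_letters_massRange (d := d) L κ a hLodd hL ha le_rfl (γ := 1 / 2) (by norm_num) (by norm_num)
  obtain ⟨δ₄, C₄, a₄, hδ₄, hC₄, ha₄, H₄⟩ := uN_hasMaj_idef_curvDressed_kingTorus_king_field_closed_massRange (d := d) L e he hLodd hL ha le_rfl (γ := 1 / 2) (by norm_num)
    (by norm_num) (α := 1 / 2) (by norm_num) (by norm_num)
  -- level-independent letters
  have hL1 : 1 ≤ L := by omega
  have hLr : (0 : ℝ) < (L : ℝ) := by exact_mod_cast (show 0 < L by omega)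
  have hLr1 : (1 : ℝ) ≤ (L : ℝ) := by exact_mod_cast hL1
  have hcd : (0 : ℝ) ≤ 1 + Fintype.card (Fin (d + 1) ⊕ Fin (d + 1)) := by positivity
  have hd' : (0 : ℝ) ≤ ((d + 1 : ℕ) : ℝ) := Nat.cast_nonneg _
  have hκ0 : 0 ≤ basisConst e := basisConst_nonneg e
  have hκs : basisConst e ≤ Real.sqrt (Fintype.card κ) := basisConst_le_sqrt_card_of_traceForm e he
  obtain ⟨S, hS_def⟩ : ∃ S : ℝ, S = Real.sqrt (Fintype.card κ) * Real.exp 1 * ((Fintype.card κ : ℝ) + (Fintype.card κ : ℝ) ^ 3) +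
      (Fintype.card κ : ℝ) * ((Fintype.card (Fin (d + 1)) : ℝ) * ((Fintype.card κ : ℝ) * (Real.sqrt (Fintype.card κ) * Real.exp 1) ^ 2 + Real.sqrt (Fintype.card κ) * Real.exp 1)) := ⟨_, rfl⟩
  have hS : 0 ≤ S := by rw [hS_def]; positivity
  obtain ⟨P, hP_def⟩ : ∃ P : ℝ, P = (Fintype.card κ : ℝ) * (Real.sqrt (Fintype.card κ) * (Real.exp 1 * ((d + 1 : ℕ) : ℝ) + 2 * Real.exp 1)) +
        (Fintype.card κ : ℝ) ^ 3 * (Real.sqrt (Fintype.card κ) * (Real.exp 1 * (((d + 1 : ℕ) : ℝ) + 1) + 2 * Real.exp 1)) +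
        (Fintype.card κ : ℝ) * ((Fintype.card (Fin (d + 1)) : ℝ) * (2 * (Fintype.card κ : ℝ) * (Real.sqrt (Fintype.card κ) * (Real.exp 1 * ((d + 1 : ℕ) : ℝ) + 2 * Real.exp 1)) *
          (Real.sqrt (Fintype.card κ) * Real.exp 1) + Real.sqrt (Fintype.card κ) * ((((d + 1 : ℕ) : ℝ) + 1) + 2 * Real.exp 1))) := ⟨_, rfl⟩
  have hP : 0 ≤ P := by rw [hP_def]; positivity
  -- ONE rate `δ₀ ≤ δ₁, δ₂, δ₄∕2`; row sums at `σ = δ₀∕4` (`δ₀ = 4σ`)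
  obtain ⟨σ, hσ_def⟩ : ∃ σ : ℝ, σ = min (min δ₁ δ₂) (δ₄ / 2) / 4 := ⟨_, rfl⟩
  have hσ : 0 < σ := by rw [hσ_def]; exact div_pos (lt_min (lt_min hδ₁ hδ₂) (half_pos hδ₄)) four_pos
  have hσδ₁ : 4 * σ ≤ δ₁ := by rw [hσ_def, mul_div_cancel₀ _ four_ne_zero]; exact (min_le_left _ _).trans (min_le_left _ _)
  have hσδ₂ : 4 * σ ≤ δ₂ := by rw [hσ_def, mul_div_cancel₀ _ four_ne_zero]; exact (min_le_left _ _).trans (min_le_right _ _)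
  have hσδ₄ : 4 * σ ≤ δ₄ / 2 := by rw [hσ_def, mul_div_cancel₀ _ four_ne_zero]; exact min_le_right _ _
  obtain ⟨cr, hcr_def⟩ : ∃ cr : ℝ, cr = B4Sect5Proof.latticeConst (d + 1) σ := ⟨_, rfl⟩
  have hc : 0 ≤ cr := by rw [hcr_def]; exact B4Sect5Proof.latticeConst_nonneg (d + 1) hσ.le
  obtain ⟨Rv, hRv_def⟩ : ∃ Rv : ℝ, Rv = S * (1 + Fintype.card (Fin (d + 1) ⊕ Fin (d + 1))) := ⟨_, rfl⟩
  have hRv : 0 ≤ Rv := by rw [hRv_def]; exact mul_nonneg hS hcd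
  obtain ⟨Ov, hOv_def⟩ : ∃ Ov : ℝ, Ov = 2 * (P * (1 + Fintype.card (Fin (d + 1) ⊕ Fin (d + 1)))) := ⟨_, rfl⟩
  have hOv : 0 ≤ Ov := by rw [hOv_def]; positivity
  -- the smallness threshold `a₀` (field level; generator letters are `2·t`, `t ≤ a₀`) and the window bound `b₃ = a₀∕(c⁺ + 1)`
  obtain ⟨D, hD_def⟩ : ∃ D : ℝ, D = 4 * β₁ * Rv * cr + 1 := ⟨_, rfl⟩
  have hD : 0 < D := by rw [hD_def]; positivity
  obtain ⟨a₀, ha₀_def⟩ : ∃ a₀ : ℝ, a₀ = min (min (1 / 2) (1 / (2 * D))) a₄ := ⟨_, rfl⟩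
  have ha₀ : 0 < a₀ := by rw [ha₀_def]; exact lt_min (lt_min (by norm_num) (by positivity)) ha₄
  have ha₀h : a₀ ≤ 1 / 2 := by rw [ha₀_def]; exact (min_le_left _ _).trans (min_le_left _ _)
  have ha₀D : a₀ ≤ 1 / (2 * D) := by rw [ha₀_def]; exact (min_le_left _ _).trans (min_le_right _ _)
  have ha₀₄ : a₀ ≤ a₄ := by rw [ha₀_def]; exact min_le_right _ _
  obtain ⟨cp, hcp_def⟩ : ∃ cp : ℝ, cp = max c35 0 := ⟨_, rfl⟩
  have hcp : 0 ≤ cp := by rw [hcp_def]; exact le_max_right _ _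
  have hcpc : c35 ≤ cp := by rw [hcp_def]; exact le_max_left _ _
  -- the constant of the conclusion
  obtain ⟨C₃, hC₃_def⟩ : ∃ C₃ : ℝ, C₃ = m₂ + β₂ * Rv * cr * (2 * C₄) * cr + (β₂ * Ov * cr + m₂ * Rv * cr) * (2 * β₁) * cr + 1 := ⟨_, rfl⟩
  have hC₃ : 0 < C₃ := by rw [hC₃_def]; positivity
  refine ⟨4 * σ - 2 * σ, C₃, a₀ / (cp + 1), by linarith only [hσ], hC₃, div_pos ha₀ (by linarith only [hcp]), fun i α₀ hα₀ hMα U hreg => ?_⟩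
  obtain ⟨hskew, hA, hgradA, hsecA⟩ := hreg
  -- the index's regimes
  have hK : 1 ≤ i.1.K := i.1.one_le_K
  have hη' : 0 < ((L : ℝ) ^ (i.1.K + 1))⁻¹ := by positivity
  have hηη₀ : (L : ℝ) * ((L : ℝ) ^ (i.1.K + 1))⁻¹ ≤ 1 := by
    rw [pow_succ', mul_inv, ← mul_assoc, mul_inv_cancel₀ hLr.ne', one_mul]
    exact inv_le_one_of_one_le₀ (one_le_pow₀ hLr1)
  have hη'1 : ((L : ℝ) ^ (i.1.K + 1))⁻¹ ≤ 1 := inv_le_one_of_one_le₀ (one_le_pow₀ hLr1)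
  have hη'η : ((L : ℝ) ^ (i.1.K + 1))⁻¹ ≤ (L : ℝ) * ((L : ℝ) ^ (i.1.K + 1))⁻¹ := le_mul_of_one_le_left hη'.le hLr1
  have hη0 : 0 ≤ (L : ℝ) * ((L : ℝ) ^ (i.1.K + 1))⁻¹ := by positivity
  have hLη : ((L : ℕ) : ℝ) * ((L : ℝ) ^ (i.1.K + 1))⁻¹ = (L : ℝ) * ((L : ℝ) ^ (i.1.K + 1))⁻¹ := rfl
  have hθ0 : 0 ≤ ((L : ℝ) ^ i.1.K) ^ (-(1 / 4 : ℝ)) := Real.rpow_nonneg (pow_nonneg hLr.le _) _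
  have hθ2 : 0 ≤ ((L : ℝ) ^ i.1.K) ^ (-(1 / 2 / 2 : ℝ)) + ((L : ℝ) ^ i.1.K) ^ (-(1 / 2 : ℝ)) :=
    add_nonneg (Real.rpow_nonneg (pow_nonneg hLr.le _) _) (Real.rpow_nonneg (pow_nonneg hLr.le _) _)
  have hθθ : ((L : ℝ) ^ i.1.K) ^ (-(1 / 2 / 2 : ℝ)) + ((L : ℝ) ^ i.1.K) ^ (-(1 / 2 : ℝ)) ≤ 2 * ((L : ℝ) ^ i.1.K) ^ (-(1 / 4 : ℝ)) := theta_le_two_rpow hL1 i.1.K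
  have hθ' : ((L : ℝ) ^ i.1.K) ^ (-(1 / 2 / 2 : ℝ)) = ((L : ℝ) ^ i.1.K) ^ (-(1 / 4 : ℝ)) := by norm_num
  have hηθ : (L : ℝ) * ((L : ℝ) ^ (i.1.K + 1))⁻¹ ≤ ((L : ℝ) ^ i.1.K) ^ (-(1 / 2 / 2 : ℝ)) + ((L : ℝ) ^ i.1.K) ^ (-(1 / 2 : ℝ)) := by
    have h1 : (L : ℝ) * ((L : ℝ) ^ (i.1.K + 1))⁻¹ = ((L : ℝ) ^ i.1.K)⁻¹ := by
      rw [pow_succ, mul_inv, ← mul_assoc, mul_comm (L : ℝ), mul_assoc, mul_inv_cancel₀ hLr.ne', mul_one]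
    rw [h1, ← Real.rpow_neg_one]
    exact (Real.rpow_le_rpow_of_exponent_le (one_le_pow₀ hLr1) (by norm_num)).trans (le_add_of_nonneg_left (Real.rpow_nonneg (pow_nonneg hLr.le _) _))
  -- the carrier facts
  have htri : Triangle254 (unitTorusGeoS L i.1.K (curvCube L i.1) i.1.Msz) := triangle254_unitTorusGeo L i.1.K (curvCube L i.1)
  have hd : ∀ a b : (unitTorusGeoS L i.1.K (curvCube L i.1) i.1.Msz).Site, 0 ≤ (unitTorusGeoS L i.1.K (curvCube L i.1) i.1.Msz).dist a b :=
    fun a b => tdistT_nonneg (curvCube L i.1) a b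
  have hd0 : ∀ y : (unitTorusGeoS L i.1.K (curvCube L i.1) i.1.Msz).Site, (unitTorusGeoS L i.1.K (curvCube L i.1) i.1.Msz).dist y y = 0 :=
    fun y => tdistT_self (curvCube L i.1) y
  have hrow : RowSum (unitTorusGeoS L i.1.K (curvCube L i.1) i.1.Msz) σ cr := by rw [hcr_def]; exact rowSum_unitTorusGeo L i.1.K (curvCube L i.1) hσ
  -- the small field `t = c⁺·(M_sz α₀) ≤ a₀`
  have hs0 : 0 ≤ i.1.Msz * α₀ := mul_nonneg (le_trans zero_le_one i.1.one_le_Msz) hα₀.le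
  obtain ⟨t, ht_def⟩ : ∃ t : ℝ, t = cp * (i.1.Msz * α₀) := ⟨_, rfl⟩
  have hct : c35 * (i.1.Msz * α₀) ≤ t := by rw [ht_def]; exact mul_le_mul_of_nonneg_right hcpc hs0
  have hta₀ : t ≤ a₀ :=
    calc t = cp * (i.1.Msz * α₀) := ht_def
      _ ≤ (cp + 1) * (i.1.Msz * α₀) := mul_le_mul_of_nonneg_right (le_add_of_nonneg_right zero_le_one) hs0
      _ ≤ (cp + 1) * (a₀ / (cp + 1)) := mul_le_mul_of_nonneg_left hMα (by linarith only [hcp])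
      _ = a₀ := by field_simp
  have hta₄ : t ≤ a₄ := hta₀.trans ha₀₄
  have h2t0 : 0 ≤ 2 * t := by rw [ht_def]; positivity
  have h2t1 : 2 * t ≤ 1 := by linarith only [hta₀, ha₀h]
  -- the window letters at `t`
  have hA' : ∀ μ y', ‖U μ y'‖ ≤ t := fun μ y' => (hA μ y').trans hct
  have hgradA' : ∀ μ ν y', ‖U μ y' - U μ (y' - unitVec (fine L (fine (L ^ i.1.K) (curvCube L i.1))) ν)‖ ≤ ((L : ℝ) ^ (i.1.K + 1))⁻¹ * t :=
    fun μ ν y' => (hgradA μ ν y').trans (mul_le_mul_of_nonneg_left hct (by positivity))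
  have hsecA' : ∀ μ ν (z' : Tor (fine L (fine (L ^ i.1.K) (curvCube L i.1)))),
      ‖(((L : ℝ) ^ (i.1.K + 1))⁻¹)⁻¹ • (U μ (z' + unitVec (fine L (fine (L ^ i.1.K) (curvCube L i.1))) ν + unitVec (fine L (fine (L ^ i.1.K) (curvCube L i.1))) μ) -
          U μ (z' + unitVec (fine L (fine (L ^ i.1.K) (curvCube L i.1))) ν)) -
        (((L : ℝ) ^ (i.1.K + 1))⁻¹)⁻¹ • (U μ (z' + unitVec (fine L (fine (L ^ i.1.K) (curvCube L i.1))) μ) - U μ z')‖ ≤ ((L : ℝ) ^ (i.1.K + 1))⁻¹ * t :=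
    fun μ ν z' => (hsecA μ ν z').trans (mul_le_mul_of_nonneg_left hct (by positivity))
  -- the generator-level letters (`Z′ = ad ∘ A′`: sizes, gradients, second differences `2t`; skew coordinates)
  have h2 : ∀ {X : Matrix n n ℂ} {c : ℝ}, ‖X‖ ≤ c → ‖adCLM ℝ X‖ ≤ 2 * c := fun hX => (norm_adCLM_le ℝ _).trans (mul_le_mul_of_nonneg_left hX two_pos.le)
  have hZ' : ∀ μ y', ‖(fun μ y' => adCLM ℝ (U μ y')) μ y'‖ ≤ 2 * t := fun μ y' => h2 (hA' μ y')
  have hgrad' : ∀ μ ν y', ‖(fun μ y' => adCLM ℝ (U μ y')) μ y' - (fun μ y' => adCLM ℝ (U μ y')) μ (y' - unitVec (fine L (fine (L ^ i.1.K) (curvCube L i.1))) ν)‖ ≤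
      ((L : ℝ) ^ (i.1.K + 1))⁻¹ * (2 * t) := fun μ ν y' => by
    show ‖adCLM ℝ (U μ y') - adCLM ℝ (U μ (y' - unitVec (fine L (fine (L ^ i.1.K) (curvCube L i.1))) ν))‖ ≤ _
    rw [adCLM_sub, mul_left_comm]; exact h2 (hgradA' μ ν y')
  have hsec' : ∀ μ ν (z' : Tor (fine L (fine (L ^ i.1.K) (curvCube L i.1)))),
      ‖(((L : ℝ) ^ (i.1.K + 1))⁻¹)⁻¹ • ((fun μ y' => adCLM ℝ (U μ y')) μ (z' + unitVec (fine L (fine (L ^ i.1.K) (curvCube L i.1))) ν + unitVec (fine L (fine (L ^ i.1.K) (curvCube L i.1))) μ) -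
          (fun μ y' => adCLM ℝ (U μ y')) μ (z' + unitVec (fine L (fine (L ^ i.1.K) (curvCube L i.1))) ν)) -
        (((L : ℝ) ^ (i.1.K + 1))⁻¹)⁻¹ • ((fun μ y' => adCLM ℝ (U μ y')) μ (z' + unitVec (fine L (fine (L ^ i.1.K) (curvCube L i.1))) μ) - (fun μ y' => adCLM ℝ (U μ y')) μ z')‖ ≤
      ((L : ℝ) ^ (i.1.K + 1))⁻¹ * (2 * t) := fun μ ν z' => by
    show ‖(((L : ℝ) ^ (i.1.K + 1))⁻¹)⁻¹ • (adCLM ℝ (U μ (z' + unitVec (fine L (fine (L ^ i.1.K) (curvCube L i.1))) ν + unitVec (fine L (fine (L ^ i.1.K) (curvCube L i.1))) μ)) -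
          adCLM ℝ (U μ (z' + unitVec (fine L (fine (L ^ i.1.K) (curvCube L i.1))) ν))) -
        (((L : ℝ) ^ (i.1.K + 1))⁻¹)⁻¹ • (adCLM ℝ (U μ (z' + unitVec (fine L (fine (L ^ i.1.K) (curvCube L i.1))) μ)) - adCLM ℝ (U μ z'))‖ ≤ _
    rw [adCLM_sub, adCLM_sub, ← adCLM_smul, ← adCLM_smul, adCLM_sub, mul_left_comm]; exact h2 (hsecA' μ ν z')
  have hZs' : ∀ μ y', (coordMat e ((fun μ y' => adCLM ℝ (U μ y')) μ y'))ᵀ = -coordMat e ((fun μ y' => adCLM ℝ (U μ y')) μ y') := fun μ y' =>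
    coordMat_adCLM_transpose_eq_neg_of_conjTranspose e he (hskew μ y')
  -- the coarse generator (block mean) and dag-n15-w3's block-mean fits
  have hZ : ∀ μ b, ‖blockMeanField L (fine (L ^ i.1.K) (curvCube L i.1)) (fun μ y' => adCLM ℝ (U μ y')) μ b‖ ≤ 2 * t := fun μ b =>
    norm_blockMeanTV_le L (fine (L ^ i.1.K) (curvCube L i.1)) h2t0 fun j => hZ' μ _
  have hgrad : ∀ μ b, ‖blockMeanField L (fine (L ^ i.1.K) (curvCube L i.1)) (fun μ y' => adCLM ℝ (U μ y')) μ b -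
      blockMeanField L (fine (L ^ i.1.K) (curvCube L i.1)) (fun μ y' => adCLM ℝ (U μ y')) μ ((torStep (fine (L ^ i.1.K) (curvCube L i.1)) μ).symm b)‖ ≤
      (L : ℝ) * ((L : ℝ) ^ (i.1.K + 1))⁻¹ * (2 * t) := fun μ b => by
    rw [torStep_symm_apply]; exact gradLetter_blockMean L (fine (L ^ i.1.K) (curvCube L i.1)) hη' h2t0 μ (hgrad' μ μ) b
  have hgrad'' : ∀ μ y', ‖(fun μ y' => adCLM ℝ (U μ y')) μ y' - (fun μ y' => adCLM ℝ (U μ y')) μ ((torStep (fine L (fine (L ^ i.1.K) (curvCube L i.1))) μ).symm y')‖ ≤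
      ((L : ℝ) ^ (i.1.K + 1))⁻¹ * (2 * t) := fun μ y' => by
    rw [torStep_symm_apply]; exact hgrad' μ μ y'
  have hfit : ∀ μ y', ‖(fun μ y' => adCLM ℝ (U μ y')) μ y' - blockMeanField L (fine (L ^ i.1.K) (curvCube L i.1)) (fun μ y' => adCLM ℝ (U μ y')) μ
      (blockOf L (fine (L ^ i.1.K) (curvCube L i.1)) y')‖ ≤ ((d + 1 : ℕ) : ℝ) * ((L : ℝ) * ((L : ℝ) ^ (i.1.K + 1))⁻¹) * (2 * t) := fun μ y' =>
    (fit_blockMeanTV L (fine (L ^ i.1.K) (curvCube L i.1)) (a' := (fun μ y' => adCLM ℝ (U μ y')) μ) (θ₁ := fun _ => ((L : ℝ) ^ (i.1.K + 1))⁻¹ * (2 * t))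
      (fun _ => mul_nonneg hη'.le h2t0) (fun y ν _ => by
        have h1 := hgrad' μ ν (y + unitVec (fine L (fine (L ^ i.1.K) (curvCube L i.1))) ν); rwa [add_sub_cancel_right] at h1) y').trans (coeff_osc_rate (d + 1) L hη'.le h2t0 rfl hLη)
  have hcompat : ∀ μ y', blockOf L (fine (L ^ i.1.K) (curvCube L i.1)) ((torStep (fine L (fine (L ^ i.1.K) (curvCube L i.1))) μ).symm y') = blockOf L (fine (L ^ i.1.K) (curvCube L i.1)) y' ∨
      blockOf L (fine (L ^ i.1.K) (curvCube L i.1)) ((torStep (fine L (fine (L ^ i.1.K) (curvCube L i.1))) μ).symm y') =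
        (torStep (fine (L ^ i.1.K) (curvCube L i.1)) μ).symm (blockOf L (fine (L ^ i.1.K) (curvCube L i.1)) y') :=
    fun μ y' => blockOf_compat_addRight L (fine (L ^ i.1.K) (curvCube L i.1)) μ y'
  have hfitT : ∀ μ y', ‖(fun μ y' => adCLM ℝ (U μ y')) μ ((torStep (fine L (fine (L ^ i.1.K) (curvCube L i.1))) μ).symm y') -
      blockMeanField L (fine (L ^ i.1.K) (curvCube L i.1)) (fun μ y' => adCLM ℝ (U μ y')) μ
        ((torStep (fine (L ^ i.1.K) (curvCube L i.1)) μ).symm (blockOf L (fine (L ^ i.1.K) (curvCube L i.1)) y'))‖ ≤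
      ((d + 1 : ℕ) : ℝ) * ((L : ℝ) * ((L : ℝ) ^ (i.1.K + 1))⁻¹) * (2 * t) + (L : ℝ) * ((L : ℝ) ^ (i.1.K + 1))⁻¹ * (2 * t) :=
    fitTranslated_of_fit_of_compat (torStep (fine (L ^ i.1.K) (curvCube L i.1))) (torStep (fine L (fine (L ^ i.1.K) (curvCube L i.1))))
      (blockOf L (fine (L ^ i.1.K) (curvCube L i.1))) hcompat hfit hgrad
  have hfitD : ∀ μ y', ‖(((L : ℝ) ^ (i.1.K + 1))⁻¹)⁻¹ • ((fun μ y' => adCLM ℝ (U μ y')) μ y' -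
        (fun μ y' => adCLM ℝ (U μ y')) μ ((torStep (fine L (fine (L ^ i.1.K) (curvCube L i.1))) μ).symm y')) -
      ((L : ℝ) * ((L : ℝ) ^ (i.1.K + 1))⁻¹)⁻¹ • (blockMeanField L (fine (L ^ i.1.K) (curvCube L i.1)) (fun μ y' => adCLM ℝ (U μ y')) μ (blockOf L (fine (L ^ i.1.K) (curvCube L i.1)) y') -
        blockMeanField L (fine (L ^ i.1.K) (curvCube L i.1)) (fun μ y' => adCLM ℝ (U μ y')) μ
          ((torStep (fine (L ^ i.1.K) (curvCube L i.1)) μ).symm (blockOf L (fine (L ^ i.1.K) (curvCube L i.1)) y')))‖ ≤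
      (((d + 1 : ℕ) : ℝ) + 1) * ((L : ℝ) * ((L : ℝ) ^ (i.1.K + 1))⁻¹) * (2 * t) := fun μ y' => by
    rw [torStep_symm_apply, torStep_symm_apply]
    exact (fit_bdiffTV_blockMeanTV L (fine (L ^ i.1.K) (curvCube L i.1)) μ hLη (a' := (fun μ y' => adCLM ℝ (U μ y')) μ)
      (θ₂ := fun _ => ((L : ℝ) ^ (i.1.K + 1))⁻¹ * (2 * t)) (fun _ => mul_nonneg hη'.le h2t0) (fun b z' _ ν => hsec' μ ν z') y').trans (species2_rate (d + 1) L hη'.le h2t0 hLη)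
  have hZs : ∀ μ b, (coordMat e (blockMeanField L (fine (L ^ i.1.K) (curvCube L i.1)) (fun μ y' => adCLM ℝ (U μ y')) μ b))ᵀ =
      -coordMat e (blockMeanField L (fine (L ^ i.1.K) (curvCube L i.1)) (fun μ y' => adCLM ℝ (U μ y')) μ b) := fun μ b =>
    blockMeanTV_skew L (fine (L ^ i.1.K) (curvCube L i.1)) e (hZs' μ) b
  -- the zero background generator (flat base point): skew coordinates
  have h0skew : (coordMat e 0)ᵀ = -coordMat e 0 := by
    have h0 := coordMat_sub e 0 0
    rw [sub_self, sub_self] at h0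
    rw [h0, Matrix.transpose_zero, neg_zero]
  -- King's nine letters at `m² = 0`, `n = 1`; the pieces on both grids (as in dag-n15-w2's Ω-f)
  have HK := fun μ : Fin (d + 1) => H₁ i.1.K hK 1 le_rfl i.1.m (curvCube L i.1) (fun _ => rfl) 0 le_rfl le_rfl i.1.Msz μ
  have maj0 : ∀ y y' : Tor (curvCube L i.1), 0 ≤ β₁ * Real.exp (-(δ₁ * tdistT (curvCube L i.1) y y')) := fun _ _ => by positivity
  have hG : HasMaj (BlockNorm.ofBlocks (unitTorusGeoS L i.1.K (curvCube L i.1) i.1.Msz) (liftBlk (blockOf (L ^ i.1.K) (curvCube L i.1)) κ))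
      (BlockNorm.ofBlocks (unitTorusGeoS L i.1.K (curvCube L i.1) i.1.Msz) (liftBlk (blockOf (L ^ i.1.K) (curvCube L i.1)) κ)) (kingGT L a 0 i.1.K (curvCube L i.1) κ)
      (fun y y' => β₁ * Real.exp (-(δ₁ * (unitTorusGeoS L i.1.K (curvCube L i.1) i.1.Msz).dist y y'))) :=
    hasMaj_tensorId κ maj0 (HK 0).1
  have hDp : ∀ j, HasMaj (BlockNorm.ofBlocks (unitTorusGeoS L i.1.K (curvCube L i.1) i.1.Msz) (liftBlk (blockOf (L ^ i.1.K) (curvCube L i.1)) κ))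
      (BlockNorm.ofBlocks (unitTorusGeoS L i.1.K (curvCube L i.1) i.1.Msz) (liftBlk (blockOf (L ^ i.1.K) (curvCube L i.1)) κ))
      (covPieces ((L : ℝ) * ((L : ℝ) ^ (i.1.K + 1))⁻¹) (torStep (fine (L ^ i.1.K) (curvCube L i.1)))
        (gaugePair (torStep (fine (L ^ i.1.K) (curvCube L i.1))) (expTrField e ((L : ℝ) * ((L : ℝ) ^ (i.1.K + 1))⁻¹) 0)) (kingGT L a 0 i.1.K (curvCube L i.1) κ) j)
      (fun y y' => β₁ * Real.exp (-(δ₁ * (unitTorusGeoS L i.1.K (curvCube L i.1) i.1.Msz).dist y y'))) := by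
    intro j
    rw [expTrField_zero, gaugePair_one]
    cases j with
    | inl μ => rw [covPieces_flat_coarse_inl]; exact hasMaj_tensorId κ maj0 (HK μ).2.1
    | inr μ => rw [covPieces_flat_coarse_inr]; exact hasMaj_tensorId κ maj0 (HK μ).2.2.1
  have hG' : HasMaj (BlockNorm.ofBlocks (unitTorusGeoS L i.1.K (curvCube L i.1) i.1.Msz) (liftBlk (blockOf (L ^ i.1.K) (curvCube L i.1) ∘ blockOf L (fine (L ^ i.1.K) (curvCube L i.1))) κ))
      (BlockNorm.ofBlocks (unitTorusGeoS L i.1.K (curvCube L i.1) i.1.Msz) (liftBlk (blockOf (L ^ i.1.K) (curvCube L i.1) ∘ blockOf L (fine (L ^ i.1.K) (curvCube L i.1))) κ))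
      (kingGT₁ L a 0 i.1.K (curvCube L i.1) κ) (fun y y' => β₁ * Real.exp (-(δ₁ * (unitTorusGeoS L i.1.K (curvCube L i.1) i.1.Msz).dist y y'))) := by
    refine hasMaj_tensorId κ maj0 ?_
    rw [blockOf_comp_blockOf_eq]
    exact hasMaj_conjEquiv _ _ (castT L i.1.K (curvCube L i.1)) maj0 (HK 0).2.2.2.1
  have hDp' : ∀ j, HasMaj (BlockNorm.ofBlocks (unitTorusGeoS L i.1.K (curvCube L i.1) i.1.Msz) (liftBlk (blockOf (L ^ i.1.K) (curvCube L i.1) ∘ blockOf L (fine (L ^ i.1.K) (curvCube L i.1))) κ))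
      (BlockNorm.ofBlocks (unitTorusGeoS L i.1.K (curvCube L i.1) i.1.Msz) (liftBlk (blockOf (L ^ i.1.K) (curvCube L i.1) ∘ blockOf L (fine (L ^ i.1.K) (curvCube L i.1))) κ))
      (covPieces (((L : ℝ) ^ (i.1.K + 1))⁻¹) (torStep (fine L (fine (L ^ i.1.K) (curvCube L i.1))))
        (gaugePair (torStep (fine L (fine (L ^ i.1.K) (curvCube L i.1)))) (expTrField e (((L : ℝ) ^ (i.1.K + 1))⁻¹) 0)) (kingGT₁ L a 0 i.1.K (curvCube L i.1) κ) j)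
      (fun y y' => β₁ * Real.exp (-(δ₁ * (unitTorusGeoS L i.1.K (curvCube L i.1) i.1.Msz).dist y y'))) := by
    intro j
    rw [expTrField_zero, gaugePair_one]
    cases j with
    | inl μ =>
        rw [covPieces_flat_fine_inl]
        refine hasMaj_tensorId κ maj0 ?_
        rw [blockOf_comp_blockOf_eq]
        exact hasMaj_conjEquiv _ _ (castT L i.1.K (curvCube L i.1)) maj0 (HK μ).2.2.2.2.1
    | inr μ =>
        rw [covPieces_flat_fine_inr]
        refine hasMaj_tensorId κ maj0 ?_
        rw [blockOf_comp_blockOf_eq]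
        exact hasMaj_conjEquiv _ _ (castT L i.1.K (curvCube L i.1)) maj0 (HK μ).2.2.2.2.2.1
  -- the Neumann smallness from the window: `q = β₁·R_V(2t)·c_r ≤ ½`
  have hRt : expRowLetter κ (Fin (d + 1)) (basisConst e) (2 * t) 0 (2 * t) * (1 + Fintype.card (Fin (d + 1) ⊕ Fin (d + 1))) ≤ 2 * t * Rv := by
    rw [hRv_def, ← mul_assoc]
    refine mul_le_mul_of_nonneg_right ?_ hcd
    rw [hS_def]
    exact expRowLetter_field_le κ (Fin (d + 1)) hκ0 hκs h2t0 h2t1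
  have hR1 : expRowLetter κ (Fin (d + 1)) (basisConst e) (2 * t) 0 (2 * t) * (1 + Fintype.card (Fin (d + 1) ⊕ Fin (d + 1))) ≤ Rv :=
    hRt.trans (mul_le_of_le_one_left hRv h2t1)
  have hq2 : β₁ * (expRowLetter κ (Fin (d + 1)) (basisConst e) (2 * t) 0 (2 * t) * (1 + Fintype.card (Fin (d + 1) ⊕ Fin (d + 1)))) * cr ≤ 1 / 2 := by
    have h1 : β₁ * (expRowLetter κ (Fin (d + 1)) (basisConst e) (2 * t) 0 (2 * t) * (1 + Fintype.card (Fin (d + 1) ⊕ Fin (d + 1)))) * cr ≤ β₁ * (2 * t * Rv) * cr :=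
      mul_le_mul_of_nonneg_right (mul_le_mul_of_nonneg_left hRt hβ₁.le) hc
    have htD : 2 * t ≤ 1 / D :=
      calc 2 * t ≤ 2 * (1 / (2 * D)) := by linarith only [hta₀, ha₀D]
        _ = 1 / D := by field_simp
    have h3 : β₁ * (2 * t * Rv) * cr ≤ β₁ * (1 / D * Rv) * cr := mul_le_mul_of_nonneg_right (mul_le_mul_of_nonneg_left (mul_le_mul_of_nonneg_right htD hRv) hβ₁.le) hc
    have h4 : β₁ * (1 / D * Rv) * cr = (β₁ * Rv * cr) / D := by ring
    have h5 : (β₁ * Rv * cr) / D ≤ 1 / 2 := by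
      rw [div_le_iff₀ hD, hD_def]
      linarith only [mul_nonneg (mul_nonneg hβ₁.le hRv) hc]
    linarith only [h1, h3, h4, h5]
  have hq1 : β₁ * (expRowLetter κ (Fin (d + 1)) (basisConst e) (2 * t) 0 (2 * t) * (1 + Fintype.card (Fin (d + 1) ⊕ Fin (d + 1)))) * cr < 1 := by linarith only [hq2]
  have hinv2 : (1 - β₁ * (expRowLetter κ (Fin (d + 1)) (basisConst e) (2 * t) 0 (2 * t) * (1 + Fintype.card (Fin (d + 1) ⊕ Fin (d + 1)))) * cr)⁻¹ ≤ 2 :=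
    inv_one_sub_le_two hq2
  -- regimes
  have hreg' : ((L : ℝ) ^ (i.1.K + 1))⁻¹ * (2 * t) ≤ 1 := mul_le_one₀ hη'1 h2t0 h2t1
  have hreg : (L : ℝ) * ((L : ℝ) ^ (i.1.K + 1))⁻¹ * (2 * t) ≤ 1 := mul_le_one₀ hηη₀ h2t0 h2t1
  have hreg1 : (1 : ℝ) * (2 * t) ≤ 1 := by rw [one_mul]; exact h2t1
  have hσδ₁' : σ ≤ δ₁ := by linarith only [hσ, hσδ₁]
  -- (1) THE SPECIES LETTERS (dag-n15-w2 g5), rate `4σ`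
  have hVf := hasMaj_unstackM_curvCoef_exp_rate_of_skew e (g := unitTorusGeoS L i.1.K (curvCube L i.1) i.1.Msz)
    (blockOf (L ^ i.1.K) (curvCube L i.1) ∘ blockOf L (fine (L ^ i.1.K) (curvCube L i.1))) (((L : ℝ) ^ (i.1.K + 1))⁻¹) (torStep (fine L (fine (L ^ i.1.K) (curvCube L i.1))))
    (fun μ y' => adCLM ℝ (U μ y')) 0 hd0 hη' hreg' (by simp) h2t0 le_rfl h2t0 hZ' (fun _ _ => by simp) hgrad'' hZs' (fun _ _ => h0skew) (4 * σ)
  have hVc := hasMaj_unstackM_curvCoef_exp_rate_of_skew e (g := unitTorusGeoS L i.1.K (curvCube L i.1) i.1.Msz) (blockOf (L ^ i.1.K) (curvCube L i.1))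
    ((L : ℝ) * ((L : ℝ) ^ (i.1.K + 1))⁻¹) (torStep (fine (L ^ i.1.K) (curvCube L i.1))) (blockMeanField L (fine (L ^ i.1.K) (curvCube L i.1)) (fun μ y' => adCLM ℝ (U μ y')))
    0 hd0 (lt_of_lt_of_le hη' hη'η) hreg (by simp) h2t0 le_rfl h2t0 hZ (fun _ _ => by simp) hgrad hZs (fun _ _ => h0skew) (4 * σ)
  have hDV := hasMaj_idef_unstackM_curvCoef_exp_rate_of_skew e (g := unitTorusGeoS L i.1.K (curvCube L i.1) i.1.Msz) (blockOf (L ^ i.1.K) (curvCube L i.1))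
    (blockOf L (fine (L ^ i.1.K) (curvCube L i.1))) ((L : ℝ) * ((L : ℝ) ^ (i.1.K + 1))⁻¹) (((L : ℝ) ^ (i.1.K + 1))⁻¹) (torStep (fine (L ^ i.1.K) (curvCube L i.1)))
    (torStep (fine L (fine (L ^ i.1.K) (curvCube L i.1)))) (blockMeanField L (fine (L ^ i.1.K) (curvCube L i.1)) (fun μ y' => adCLM ℝ (U μ y')))
    0 (fun μ y' => adCLM ℝ (U μ y')) 0 hd0 (η₀ := 1) hreg1 (by simp) hη' hη'η hηη₀ h2t0 le_rfl h2t0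
    (by positivity) (by positivity)
    (show (0 : ℝ) ≤ ((d + 1 : ℕ) : ℝ) * ((L : ℝ) * ((L : ℝ) ^ (i.1.K + 1))⁻¹) * 0 + (L : ℝ) * ((L : ℝ) ^ (i.1.K + 1))⁻¹ * 0 by simp) (by positivity) hZ hZ'
    (fun _ _ => by simp) (fun _ _ => by simp) hgrad hgrad'' hfit hfitT (fun _ _ => by simp) hfitD hZs (fun _ _ => h0skew) hZs' (fun _ _ => h0skew) (4 * σ)
  -- (2) THE COARSE PAIR's ROWS (dag-n15-w2, smallness discharged) and THE TWO NEUMANN UNITS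
  have hXc := hasMaj_curvDressed_exp_of_skew e (g := unitTorusGeoS L i.1.K (curvCube L i.1) i.1.Msz)
    ((L : ℝ) * ((L : ℝ) ^ (i.1.K + 1))⁻¹) (torStep (fine (L ^ i.1.K) (curvCube L i.1))) (blockMeanField L (fine (L ^ i.1.K) (curvCube L i.1)) (fun μ y' => adCLM ℝ (U μ y')))
    0 (blockOf (L ^ i.1.K) (curvCube L i.1)) (kingGT L a 0 i.1.K (curvCube L i.1) κ) (ρ := 4 * σ - σ) htri hd hrow hσ.le (by linarith only [hσ])
    (by linarith only [hσδ₁]) hβ₁.le (lt_of_lt_of_le hη' hη'η) h2t0 le_rfl h2t0 hreg (by simp) hZ (fun _ _ => by simp) hgrad hZs (fun _ _ => h0skew) hG hDp hq1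
  have hunitF := isUnit_curvDressed_exp_of_skew e (g := unitTorusGeoS L i.1.K (curvCube L i.1) i.1.Msz) (((L : ℝ) ^ (i.1.K + 1))⁻¹)
    (torStep (fine L (fine (L ^ i.1.K) (curvCube L i.1)))) (fun μ y' => adCLM ℝ (U μ y')) 0 (blockOf (L ^ i.1.K) (curvCube L i.1) ∘ blockOf L (fine (L ^ i.1.K) (curvCube L i.1)))
    (kingGT₁ L a 0 i.1.K (curvCube L i.1) κ) hd hrow hσδ₁' hβ₁.le hη' h2t0 le_rfl h2t0 hreg' (by simp) hZ' (fun _ _ => by simp) hgrad'' hZs' (fun _ _ => h0skew) hG' hDp' hq1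
  have hunitC := isUnit_curvDressed_exp_of_skew e (g := unitTorusGeoS L i.1.K (curvCube L i.1) i.1.Msz)
    ((L : ℝ) * ((L : ℝ) ^ (i.1.K + 1))⁻¹) (torStep (fine (L ^ i.1.K) (curvCube L i.1))) (blockMeanField L (fine (L ^ i.1.K) (curvCube L i.1)) (fun μ y' => adCLM ℝ (U μ y')))
    0 (blockOf (L ^ i.1.K) (curvCube L i.1)) (kingGT L a 0 i.1.K (curvCube L i.1) κ) hd hrow hσδ₁' hβ₁.le (lt_of_lt_of_le hη' hη'η) h2t0 le_rfl h2t0 hreg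
    (by simp) hZ (fun _ _ => by simp) hgrad hZs (fun _ _ => h0skew) hG hDp hq1
  -- (3) THE LAPLACIAN LETTERS (part XXXVIII) and THE PAIR DEFECT (part XXXII) at `m² = 0`
  obtain ⟨hD3f, hDD3⟩ := H₂ i.1 0 le_rfl le_rfl
  have hDX := H₄ i.1.K hK i.1.m (curvCube L i.1) (fun _ => rfl) 0 le_rfl le_rfl i.1.Msz U (fun μ y' => (hA' μ y').trans hta₄)
    (fun μ ν y' => (hgradA' μ ν y').trans (mul_le_mul_of_nonneg_left hta₄ (by positivity)))
    (fun μ ν z' => (hsecA' μ ν z').trans (mul_le_mul_of_nonneg_left hta₄ (by positivity))) hskew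
  rw [blockMeanField_zero] at hDX
  -- (4) THE TWO RESOLVENT IDENTITIES `Δ∘X = ΔG + (ΔG∘V̂)∘X̂` ((3.65), dag-n15-c M1 `projO_none_bgPairM`)
  have eF : curvLapF L κ i.1 ∘ₗ curvXfo L κ e a i.1 U = (curvLapF L κ i.1 ∘ₗ (kingGT₁ L a 0 i.1.K (curvCube L i.1) κ)) + ((curvLapF L κ i.1 ∘ₗ (kingGT₁ L a 0 i.1.K (curvCube L i.1) κ)) ∘ₗ unstackM (curvCoefC (((L : ℝ) ^ (i.1.K + 1))⁻¹) (torStep (fine L (fine (L ^ i.1.K) (curvCube L i.1)))) (expTrField e (((L : ℝ) ^ (i.1.K + 1))⁻¹) 0) (expTrField e (((L : ℝ) ^ (i.1.K + 1))⁻¹) (fun μ y' => adCLM ℝ (U μ y')))) (curvCoefA (((L : ℝ) ^ (i.1.K + 1))⁻¹) (torStep (fine L (fine (L ^ i.1.K) (curvCube L i.1)))) (expTrField e (((L : ℝ) ^ (i.1.K + 1))⁻¹) 0) (expTrField e (((L : ℝ) ^ (i.1.K + 1))⁻¹) (fun μ y' => adCLM ℝ (U μ y'))))) ∘ₗ curvDressed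 (((L : ℝ) ^ (i.1.K + 1))⁻¹) (torStep (fine L (fine (L ^ i.1.K) (curvCube L i.1)))) (expTrField e (((L : ℝ) ^ (i.1.K + 1))⁻¹) 0) (expTrField e (((L : ℝ) ^ (i.1.K + 1))⁻¹) (fun μ y' => adCLM ℝ (U μ y'))) (kingGT₁ L a 0 i.1.K (curvCube L i.1) κ) := by
    unfold curvXfo curvDressed
    rw [projO_none_bgPairM hunitF, LinearMap.comp_add]
    rfl
  have eC : curvLapC L κ i.1 ∘ₗ (projO (none : Option (Fin (d + 1) ⊕ Fin (d + 1))) ∘ₗ curvDressed ((L : ℝ) * ((L : ℝ) ^ (i.1.K + 1))⁻¹) (torStep (fine (L ^ i.1.K) (curvCube L i.1))) (expTrField e ((L : ℝ) * ((L : ℝ) ^ (i.1.K + 1))⁻¹) 0) (expTrField e ((L : ℝ) * ((L : ℝ) ^ (i.1.K + 1))⁻¹) (blockMeanField L (fine (L ^ i.1.K) (curvCube L i.1)) (fun μ y' => adCLM ℝ (U μ y')))) (kingGT L a 0 i.1.K (curvCube L i.1) κ)) =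
      (curvLapC L κ i.1 ∘ₗ (kingGT L a 0 i.1.K (curvCube L i.1) κ)) + ((curvLapC L κ i.1 ∘ₗ (kingGT L a 0 i.1.K (curvCube L i.1) κ)) ∘ₗ unstackM (curvCoefC ((L : ℝ) * ((L : ℝ) ^ (i.1.K + 1))⁻¹) (torStep (fine (L ^ i.1.K) (curvCube L i.1))) (expTrField e ((L : ℝ) * ((L : ℝ) ^ (i.1.K + 1))⁻¹) 0) (expTrField e ((L : ℝ) * ((L : ℝ) ^ (i.1.K + 1))⁻¹) (blockMeanField L (fine (L ^ i.1.K) (curvCube L i.1)) (fun μ y' => adCLM ℝ (U μ y'))))) (curvCoefA ((L : ℝ) * ((L : ℝ) ^ (i.1.K + 1))⁻¹) (torStep (fine (L ^ i.1.K) (curvCube L i.1))) (expTrField e ((L : ℝ) * ((L : ℝ) ^ (i.1.K + 1))⁻¹) 0) (expTrField e ((L : ℝ) * ((L : ℝ) ^ (i.1.K + 1))⁻¹) (blockMeanField L (fine (L ^ i.1.K) (curvCube L i.1)) (fun μ y' => adCLM ℝ (U μ y')))))) ∘ₗ curvDressed ((L : ℝ) * ((L : ℝ) ^ (i.1.K +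 1))⁻¹) (torStep (fine (L ^ i.1.K) (curvCube L i.1))) (expTrField e ((L : ℝ) * ((L : ℝ) ^ (i.1.K + 1))⁻¹) 0) (expTrField e ((L : ℝ) * ((L : ℝ) ^ (i.1.K + 1))⁻¹) (blockMeanField L (fine (L ^ i.1.K) (curvCube L i.1)) (fun μ y' => adCLM ℝ (U μ y')))) (kingGT L a 0 i.1.K (curvCube L i.1) κ) := by
    unfold curvDressed
    rw [projO_none_bgPairM hunitC, LinearMap.comp_add]
    rfl
  -- (5) THE LETTERS AT ONE RATE `4σ` (weakenings) and THE KNIT (§1)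
  have hEx : ∀ y y' : Tor (curvCube L i.1), 0 ≤ Real.exp (-(4 * σ * tdistT (curvCube L i.1) y y')) := fun _ _ => Real.exp_nonneg _
  have hθm : 0 ≤ m₂ * ((L : ℝ) ^ i.1.K) ^ (-(1 / 2 / 2 : ℝ)) := mul_nonneg hm₂.le (Real.rpow_nonneg (pow_nonneg hLr.le _) _)
  have hD3f' : HasMaj (BlockNorm.ofBlocks (unitTorusGeoS L i.1.K (curvCube L i.1) i.1.Msz) (liftBlk (blockOf (L ^ i.1.K) (curvCube L i.1) ∘ blockOf L (fine (L ^ i.1.K) (curvCube L i.1))) κ)) (BlockNorm.ofBlocks (unitTorusGeoS L i.1.K (curvCube L i.1) i.1.Msz) (liftBlk (blockOf (L ^ i.1.K) (curvCube L i.1) ∘ blockOf L (fine (L ^ i.1.K) (curvCube L i.1))) κ)) (curvLapF L κ i.1 ∘ₗ (kingGT₁ L a 0 i.1.K (curvCube L i.1) κ)) (fun y y' => β₂ * Real.exp (-(4 * σ * tdistT (curvCube L i.1) y y'))) :=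
    hasMaj_exp_weaken L hβ₂.le le_rfl hσδ₂ hD3f
  have hDD3' : HasMaj (BlockNorm.ofBlocks (unitTorusGeoS L i.1.K (curvCube L i.1) i.1.Msz) (liftBlk (blockOf (L ^ i.1.K) (curvCube L i.1)) κ)) (BlockNorm.ofBlocks (unitTorusGeoS L i.1.K (curvCube L i.1) i.1.Msz) (liftBlk (blockOf (L ^ i.1.K) (curvCube L i.1) ∘ blockOf L (fine (L ^ i.1.K) (curvCube L i.1))) κ))
      (idef (pull (liftMap (blockOf L (fine (L ^ i.1.K) (curvCube L i.1))) κ)) (pull (liftMap (blockOf L (fine (L ^ i.1.K) (curvCube L i.1))) κ)) (curvLapF L κ i.1 ∘ₗ (kingGT₁ L a 0 i.1.K (curvCube L i.1) κ)) (curvLapC L κ i.1 ∘ₗ (kingGT L a 0 i.1.K (curvCube L i.1) κ)))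
      (fun y y' => m₂ * ((L : ℝ) ^ i.1.K) ^ (-(1 / 2 / 2 : ℝ)) * Real.exp (-(4 * σ * tdistT (curvCube L i.1) y y'))) :=
    hasMaj_exp_weaken L hθm le_rfl hσδ₂ hDD3
  have hVf' := hVf.mono fun y y' => mul_le_mul_of_nonneg_right hR1 (hEx y y')
  have hVc' := hVc.mono fun y y' => mul_le_mul_of_nonneg_right hR1 (hEx y y')
  -- the fit letter `≤ O_v·θ` (`Lη′ ≤ (L^K)^{−¼} + (L^K)^{−½} ≤ 2(L^K)^{−¼}`)
  have hfitle := expFitLetter_field_le κ (Fin (d + 1)) (η := (L : ℝ) * ((L : ℝ) ^ (i.1.K + 1))⁻¹) (d' := ((d + 1 : ℕ) : ℝ)) hκ0 hκs h2t0 h2t1 hη0 hd'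
  rw [← hP_def] at hfitle
  have hOθ : expFitLetter κ (Fin (d + 1)) (basisConst e) (2 * t) 0 (2 * t) (((d + 1 : ℕ) : ℝ) * ((L : ℝ) * ((L : ℝ) ^ (i.1.K + 1))⁻¹) * (2 * t))
        (((d + 1 : ℕ) : ℝ) * ((L : ℝ) * ((L : ℝ) ^ (i.1.K + 1))⁻¹) * (2 * t) + (L : ℝ) * ((L : ℝ) ^ (i.1.K + 1))⁻¹ * (2 * t))
        (((d + 1 : ℕ) : ℝ) * ((L : ℝ) * ((L : ℝ) ^ (i.1.K + 1))⁻¹) * 0 + (L : ℝ) * ((L : ℝ) ^ (i.1.K + 1))⁻¹ * 0)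
        ((((d + 1 : ℕ) : ℝ) + 1) * ((L : ℝ) * ((L : ℝ) ^ (i.1.K + 1))⁻¹) * (2 * t)) ((L : ℝ) * ((L : ℝ) ^ (i.1.K + 1))⁻¹) * (1 + Fintype.card (Fin (d + 1) ⊕ Fin (d + 1))) ≤
      Ov * ((L : ℝ) ^ i.1.K) ^ (-(1 / 4 : ℝ)) := by
    have h1 := mul_le_mul_of_nonneg_right hfitle hcd
    have h2 : (L : ℝ) * ((L : ℝ) ^ (i.1.K + 1))⁻¹ * P * (1 + Fintype.card (Fin (d + 1) ⊕ Fin (d + 1))) ≤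
        2 * ((L : ℝ) ^ i.1.K) ^ (-(1 / 4 : ℝ)) * P * (1 + Fintype.card (Fin (d + 1) ⊕ Fin (d + 1))) := mul_le_mul_of_nonneg_right (mul_le_mul_of_nonneg_right (hηθ.trans hθθ) hP) hcd
    rw [hOv_def]
    linarith only [h1, h2]
  have hDV' := hDV.mono fun y y' => mul_le_mul_of_nonneg_right hOθ (hEx y y')
  have hDX' : HasMaj (BlockNorm.ofBlocks (unitTorusGeoS L i.1.K (curvCube L i.1) i.1.Msz) (liftBlk (blockOf (L ^ i.1.K) (curvCube L i.1)) κ)) (BlockNorm.ofBlocks (unitTorusGeoS L i.1.K (curvCube L i.1) i.1.Msz) (blkPair (liftBlk (blockOf (L ^ i.1.K) (curvCube L i.1) ∘ blockOf L (fine (L ^ i.1.K) (curvCube L i.1))) κ)))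
      (idef (pull (liftMap (blockOf L (fine (L ^ i.1.K) (curvCube L i.1))) κ)) (pull (liftPair (liftMap (blockOf L (fine (L ^ i.1.K) (curvCube L i.1))) κ))) (curvDressed (((L : ℝ) ^ (i.1.K + 1))⁻¹) (torStep (fine L (fine (L ^ i.1.K) (curvCube L i.1)))) (expTrField e (((L : ℝ) ^ (i.1.K + 1))⁻¹) 0) (expTrField e (((L : ℝ) ^ (i.1.K + 1))⁻¹) (fun μ y' => adCLM ℝ (U μ y'))) (kingGT₁ L a 0 i.1.K (curvCube L i.1) κ)) (curvDressed ((L : ℝ) * ((L : ℝ) ^ (i.1.K + 1))⁻¹) (torStep (fine (L ^ i.1.K) (curvCube L i.1))) (expTrField e ((L : ℝ) * ((L : ℝ) ^ (i.1.K + 1))⁻¹) 0) (expTrField e ((L : ℝ) * ((L : ℝ) ^ (i.1.K + 1))⁻¹) (blockMeanField L (fine (L ^ i.1.K) (curvCube L i.1)) (fun μ y' => adCLM ℝ (U μ y')))) (kingGT L a 0 i.1.K (curvCube L i.1) κ)))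
      (fun y y' => 2 * C₄ * ((L : ℝ) ^ i.1.K) ^ (-(1 / 4 : ℝ)) * Real.exp (-(4 * σ * tdistT (curvCube L i.1) y y'))) := by
    refine hasMaj_exp_weaken L (mul_nonneg hC₄.le hθ2) ?_ hσδ₄ hDX
    nlinarith only [hθθ, hC₄.le]
  have hXc' : HasMaj (BlockNorm.ofBlocks (unitTorusGeoS L i.1.K (curvCube L i.1) i.1.Msz) (liftBlk (blockOf (L ^ i.1.K) (curvCube L i.1)) κ)) (BlockNorm.ofBlocks (unitTorusGeoS L i.1.K (curvCube L i.1) i.1.Msz) (blkPair (liftBlk (blockOf (L ^ i.1.K) (curvCube L i.1)) κ))) (curvDressed ((L : ℝ) * ((L : ℝ) ^ (i.1.K + 1))⁻¹) (torStep (fine (L ^ i.1.K) (curvCube L i.1))) (expTrField e ((L : ℝ) * ((L : ℝ) ^ (i.1.K + 1))⁻¹) 0) (expTrField e ((L : ℝ) * ((L : ℝ) ^ (i.1.K + 1))⁻¹) (blockMeanField L (fine (L ^ i.1.K) (curvCube L i.1)) (fun μ y' => adCLM ℝ (U μ y')))) (kingGT L a 0 i.1.K (curvCube L i.1) κ))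
      (fun y y' => 2 * β₁ * Real.exp (-((4 * σ - σ) * tdistT (curvCube L i.1) y y'))) := by
    refine hXc.mono fun y y' => mul_le_mul_of_nonneg_right ?_ (Real.exp_nonneg _)
    calc β₁ * (1 - β₁ * (expRowLetter κ (Fin (d + 1)) (basisConst e) (2 * t) 0 (2 * t) * (1 + Fintype.card (Fin (d + 1) ⊕ Fin (d + 1)))) * cr)⁻¹ ≤ β₁ * 2 :=
          mul_le_mul_of_nonneg_left hinv2 hβ₁.le
      _ = 2 * β₁ := mul_comm _ _
  have hknit := hasMaj_idef_derived_of_letters (g := unitTorusGeoS L i.1.K (curvCube L i.1) i.1.Msz) (liftBlk (blockOf (L ^ i.1.K) (curvCube L i.1)) κ)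
    (liftBlk (blockOf (L ^ i.1.K) (curvCube L i.1) ∘ blockOf L (fine (L ^ i.1.K) (curvCube L i.1))) κ) (liftMap (blockOf L (fine (L ^ i.1.K) (curvCube L i.1))) κ)
    htri hd hc hrow (δ := 4 * σ) hσ.le le_rfl hβ₂.le hRv (mul_nonneg hOv hθ0) (by positivity) hθm (by positivity) hD3f' hDD3' hVf' hVc' hDV' hDX' hXc'
  -- (6) THE ENTRY-3 OPERATOR IS THE KNITTED ONE
  show HasMaj (BlockNorm.ofBlocks (unitTorusGeoS L i.1.K (curvCube L i.1) i.1.Msz) (liftBlk (blockOf (L ^ i.1.K) (curvCube L i.1)) κ)) (BlockNorm.ofBlocks (unitTorusGeoS L i.1.K (curvCube L i.1) i.1.Msz) (liftBlk (blockOf (L ^ i.1.K) (curvCube L i.1) ∘ blockOf L (fine (L ^ i.1.K) (curvCube L i.1))) κ)) (idef (pull (liftMap (blockOf L (fine (L ^ i.1.K) (curvCube L i.1))) κ)) (pull (liftMap (blockOf L (fine (L ^ i.1.K) (curvCube L i.1))) κ))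
    (curvLapF L κ i.1 ∘ₗ curvXfo L κ e a i.1 U) (curvLapC L κ i.1 ∘ₗ curvXco L κ e a i.1 ((curvPairing L κ i.1).avg U))) _
  rw [curvXco_avg, blockMeanField_zero, eF, eC]
  refine hknit.mono fun y y' => ?_
  have hA : m₂ * ((L : ℝ) ^ i.1.K) ^ (-(1 / 2 / 2 : ℝ)) + β₂ * Rv * cr * (2 * C₄ * ((L : ℝ) ^ i.1.K) ^ (-(1 / 4 : ℝ))) * cr +
      (β₂ * (Ov * ((L : ℝ) ^ i.1.K) ^ (-(1 / 4 : ℝ))) * cr + m₂ * ((L : ℝ) ^ i.1.K) ^ (-(1 / 2 / 2 : ℝ)) * Rv * cr) * (2 * β₁) * cr = (C₃ - 1) * ((L : ℝ) ^ i.1.K) ^ (-(1 / 4 : ℝ)) := by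
    rw [hθ', hC₃_def]; ring
  rw [hA]
  have hE : 0 ≤ Real.exp (-((4 * σ - 2 * σ) * tdistT (curvCube L i.1) y y')) := Real.exp_nonneg _
  nlinarith only [hθ0, hE, mul_nonneg hθ0 hE]
end Letters3
end Summit.QuantumFields.YangMills.BalabanUVNodes.N15.SiteLayerBg
end
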